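import Summits.BirchSwinnertonDyer.Rank1Residual.Partition.MainConjecturesEisensteinBDP
import Summits.BirchSwinnertonDyer.Rank1Residual.Partition.MainConjecturesEisensteinTwistCertificate
import Summits.BirchSwinnertonDyer.Rank1Residual.AdditivePotMult.RankZeroShaAnIdentity
import HarnessLib

/-!
# Row D4 ∩ {r = 0}: the MIRROR twist road — `BSD(E,p)` for the rank-ZERO curve from the `p`-part of
# BSD for its rank-ONE Heegner twist, through CGLS22 Thm. 4.2.2 ∘ 5.1.3 / Thm. 5.1.1 over `K`

HONEST FRAMING (cell `bsd-litref`, programme `BSD-LIT2PART-PROGRAMME-v1.md` §T2d, verbatim): "no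
tranche here proves BSD; ARM L moves the LITERAL column of an r ≤ 1 census into the kernel-proved-
modulo-named-print column". `Proofs`-style Summits file: THEOREMS ONLY. Seat `bsd-litref-cgs25-pv`.

## What and why

Row D4 (flag `CGS25-BST-Thm311`) has 148 rank-ZERO classes (145 at `p = 3`): good, `E[p]` reducible,
`a_p ≢ 1 (mod p)`, `ord_{s=1}L(E,s) = 0` and `p ∣ #Ш_an(E)` (so Wuthrich's one-sided bound does not
close them). The rank-ONE twist road of `MainConjecturesEisensteinTwistCertificate` (p455255) reads
CGLS22's display (5.5) at `(E, K)` with `E` of analytic rank one. This file is its MIRROR: `E` of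
analytic rank ZERO and an imaginary quadratic Heegner field `K` (every `ℓ ∣ N_E` split, `p` split,
`d_K` odd `< −4`) whose twist `E^{(d_K)}` has analytic rank ONE — then `L(E/K, s)` again vanishes to
order one, the Heegner point `P_K` is non-torsion, and

* display (5.5) over `K` — `ord_p #Ш(E/K) = 2·ord_p(c_E⁻¹[E(K):ℤP_K]) − Σ_w ord_p c_w(E/K)` — holds at
  the datum by the tree's `display55_at_of_display54_of_thm511` from the PUBLISHED CGLS22 Thm. 4.2.2 ∘
  Thm. 5.1.3 (`display54_thm513_generator_constantCoeff`, A173) and Thm. 5.1.1 (anticyclotomic control,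
  `thm511_anticyclotomicControl`, A170), whose hypotheses are `rank_ℤ E(K) = 1`, `Ш(E/K)` finite,
  `P_K` non-torsion — NOT a placement of the rank on `E` (the cell's lit-cgls typing of §4–§5 of the
  paper; A157's own binder `r_an(E) = 1` is only the setting of Thm. 5.3.1's proof);
* the Gross–Zagier bookkeeping with the ranks EXCHANGED is the tree theorem
  `AdditivePotMult.exists_shaAn_padicVal_eq_of_heegner_rankZero` (cell additive-p1 gen 13):
  `ord_p #Ш_an(E^K) + ord_p(L(E,1)/Ω_E) + ord_p ∏c(E^K) + 2 ord_p #E(ℚ)_tors = 2 ord_p [E(K):ℤP_K]` and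
  `ord_p #Ш(E/K) = ord_p #Ш(E) + ord_p #Ш(E^K)`.

Combining the two with the Tamagawa relation over `K` (`X11b.padicValNat_tamagawaProduct_baseChange_
quadratic_of_heegner_of_odd`) gives, at a datum with `p ∤ c_E`:

* `RowC6.bsdp_rankZero_of_mainConjectures_of_bsdp_twist` — **`BSD(E^K, p) ⟹ BSD(E, p)`** for the
  rank-zero row-C6 pair, from A173 + A170 + Gross–Zagier + Kolyvagin + GZK + modularity (all
  PUBLISHED, REFEREED, Beilinson–Flach-free), given the data: a parametrisation datum `Dt` with
  `p ∤ c(Dt)` (Manin; `c = 1` on Cremona's optimal curves where known), `K` as above, a globally minimal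
  model `Wd` of `E^{(d_K)}` with `ord_{s=1}L(Wd,s) = 1`, and `BSDp Wd p`.
* `RowC6.bsdp_rankZero_of_mainConjectures_of_twoStepTwist` — the PER-CLASS closed form: `BSDp Wd p`
  supplied by the rank-ONE twist road on `Wd` with a second imaginary quadratic field `K'` and the
  certificate `ord_p #Ш_an(Wd^{(d_{K'})}) = 0` (a REAL quadratic twist `E^{(d_K d_{K'})}` of `E`), display
  (5.5) derived from A173 + A170. Data per class: `(Dt: p ∤ c)`, `K`, `Wd` (`r_an = 1`), `K'`, `Wdd`
  (`L ≠ 0`, `#Ш_an` a `p`-unit) — all decidable by the lane's engines.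

USE (per class, row D4 ∩ {r = 0}): `Wd` is a rank-ONE good Eisenstein non-anomalous curve at `p`
(`partner_good_red_not_anom`) of Greenberg–Vatsal parity type opposite to `E`'s; `BSDp Wd p` is then
supplied per class by the rank-one TWIST road (`RowC6.bsdp_rankOne_of_display55_of_twistShaAnUnit[_key]`
applied to `Wd` and a second imaginary quadratic field `K'` Heegner for `N_{Wd} = N_E·d_K²`, i.e. a
certificate `ord_p #Ш_an(E^{(d_K d_{K'})}) = 0` on a REAL quadratic twist of `E`), or by x1b's
Schneider road — a two-step certificate chain, every step refereed print + kernel. Nothing is booked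
here; the Manin binder `hc` and the two certificates are the lane's per-class data.

References: [CastellaGrossiLeeSkinner2022] Thm. 4.2.2, Thm. 5.1.1, Thm. 5.1.3, proof of Thm. 5.3.1
(5.4)–(5.5); [GrossZagier1986] I.(6.5), V.§2; [Gross1991] Thm. 1.3; [JetchevSkinnerWan2017] §7.4.1;
[Miller2011LMS] Def. 1.1; tree: `Partition/MainConjecturesEisensteinBDP.lean` (lit-cgls session 6),
`AdditivePotMult/RankZeroShaAnIdentity.lean` (additive-p1 gen 13).
-/

set_option autoImplicit false

noncomputable section

open scoped Classical

open WeierstrassCurve NumberField IsDedekindDomain Literature.NumberTheory.EllipticCurves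
  Literature.NumberTheory.EllipticCurves.ModularForms Literature.NumberTheory.QuadraticFields
  Literature.NumberTheory.EllipticCurves.Rank1Residual
  Literature.NumberTheory.EllipticCurves.CastellaGrossiLeeSkinner2022

namespace Summit.BirchSwinnertonDyer.Rank1Residual

/-- **Row D4 ∩ {r = 0}: `BSD(E^K,p)` for the rank-ONE Heegner twist ⟹ `BSD(E,p)` for the rank-ZERO
curve.** Data: `W/ℚ` globally minimal elliptic, `p > 2` good with `E[p]` reducible and
`a_p ≢ 1 (mod p)`, `ord_{s=1}L(E,s) = 0`; a parametrisation datum `Dt` of level `N` with Manin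
constant prime to `p` (`hc`); `K` imaginary quadratic, `d_K` odd `< −4`, Heegner for `N` and for `p`;
`Wd = Cd • E^{(d_K)}` globally minimal with `ord_{s=1}L(Wd,s) = 1` and `BSDp Wd p`. Named facts
(PUBLISHED, refereed, no Beilinson–Flach class): CGLS22 Thm. 4.2.2 ∘ 5.1.3 (`h54`, A173) and Thm. 5.1.1
(`h511`, A170), modularity (`hmodP`, `hnf`), Gross–Zagier (`hGZ`), Kolyvagin (`hKo`), GZK (`hGZK`).
Proof: `L'(E/K,1) = L(E,1)·L'(E^K,1) ≠ 0` (`AdditivePotMult.lDerivEK_eq_mul_deriv`) makes the Heegner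
point non-torsion (Gross–Zagier) and `rank E(K) = 1`, `Ш(E/K)` finite (Kolyvagin); display (5.5) at
the datum (`display55_at_of_display54_of_thm511`, anticyclotomic datum produced as in
`display55_of_display54_of_thm511`); the rank-zero Gross–Zagier bookkeeping
(`AdditivePotMult.exists_shaAn_padicVal_eq_of_heegner_rankZero`); the Tamagawa relation over `K`;
then `BSDp Wd p` turns the sum into the rank-zero print shape of `W`, and `bsdp_of_pPartRankZero`.
[cite: CastellaGrossiLeeSkinner2022, Thm. 4.2.2, Thm. 5.1.1, Thm. 5.1.3, proof of Thm. 5.3.1 (5.4)–(5.5)]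
[cite: GrossZagier1986, I.(6.5), V.§2 (pp. 310–312)] [cite: Gross1991, Thm. 1.3]
[cite: JetchevSkinnerWan2017, §7.4.1 (eq:gz for K′), p. 30] [cite: Miller2011LMS, Def. 1.1] -/
theorem RowC6.bsdp_rankZero_of_mainConjectures_of_bsdp_twist
    (h54 : display54_thm513_generator_constantCoeff) (h511 : thm511_anticyclotomicControl)
    (hmodP : nonempty_modularParametrizationData) (hnf : exists_isNewformOf)
    (hGZ : ∀ (N : ℕ) [NeZero N] (W : WeierstrassCurve ℚ) (K : Type) [Field K] [NumberField K],
      gross_zagier N W K)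
    (hKo : ∀ (N : ℕ) [NeZero N] (W : WeierstrassCurve ℚ) (K : Type) [Field K] [NumberField K],
      kolyvagin N W K)
    (hGZK : rank_eq_analyticRank_of_analyticRank_le_one)
    (W : WeierstrassCurve ℚ) [W.IsElliptic] [W.IsGloballyMinimal] (p : ℕ) [Fact p.Prime]
    (hp : 2 < p) (hgood : Good W p) (hred : Red W p) (hna : ¬ Anom W p) (hr0 : W.analyticRank = 0)
    (N : ℕ) [NeZero N] (Dt : ModularParametrizationData W N) (hc : ¬ (p : ℤ) ∣ Dt.c)
    (K : Type) [Field K] [NumberField K] (hK : IsImaginaryQuadratic K)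
    (hodd : Odd (NumberField.discr K)) (hlt : NumberField.discr K < -4)
    (hHN : SatisfiesHeegnerHypothesis N K) (hHp : SatisfiesHeegnerHypothesis p K)
    (Wd : WeierstrassCurve ℚ) [Wd.IsElliptic] [Wd.IsGloballyMinimal] (Cd : VariableChange ℚ)
    (hWd : Cd • W.quadraticTwist (NumberField.discr K : ℚ) = Wd) (hrd : Wd.analyticRank = 1)
    (hBd : BSDp Wd p) : BSDp W p := by
  have hpP : p.Prime := Fact.out
  have hp2 : p ≠ 2 := by omega
  have hmod : hasEntireLFunction_rat := hasEntireLFunction_rat_of_exists_isNewformOf hnf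
  -- the level of the parametrisation is the conductor
  have hN : N = W.conductorNorm ℤ :=
    IsNewformOf.level_eq_conductorNorm_of_exists_isNewformOf hnf Dt.isNewformOf
  have hHN' : SatisfiesHeegnerHypothesis (W.conductorNorm ℤ) K := by rw [← hN]; exact hHN
  -- a Heegner datum and the `K`-rational Heegner point
  obtain ⟨β, hβ⟩ := exists_dvd_sq_sub_discr_holds N K hK hHN
  obtain ⟨H, -⟩ := nonempty_heegnerDatum_holds N K hK hβ
  obtain ⟨ι⟩ : Nonempty (K →+* ℂ) := inferInstance
  obtain ⟨P, hP⟩ := heegnerPointComplex_mem_range_map_holds N W K hK hHN Dt H ι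
  have hPH : IsHeegnerPoint N W K P := ⟨Dt, H, ι, hP⟩
  -- `ord_p u(Cd) = 0`, `p ∤ w_K`
  have hu : padicValRat p (Cd.u : ℚ) = 0 :=
    AdditivePotMult.padicValRat_u_eq_zero_of_twist_minimal_of_split W p K hK hHp Cd hWd
  have hμ : ¬ p ∣ Units.torsionOrder K := X2.not_dvd_unitsTorsionOrder_of_discr_lt hK hlt hpP hp2
  -- the rational `L(E,1)/Ω_E`
  obtain ⟨q0, hq0⟩ := X1.RankZeroPartner.exists_rat_entireLFunction_one_div_realPeriodRat hmodP W
  -- the rank-zero Gross–Zagier bookkeeping identity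
  obtain ⟨hfinW, hfinK, hshaK, q, hq, hval⟩ :=
    AdditivePotMult.exists_shaAn_padicVal_eq_of_heegner_rankZero W p N K Dt H ι P (hGZ N W K) (hKo N W K)
      hGZK hmod hK hHN hP hp2 hc hμ hr0 Wd Cd hWd hu hrd q0 hq0
  haveI : Finite (W.baseChange K).sha := hfinK
  -- `L'(E/K,1) = L(E,1)·L'(E^K,1) ≠ 0`: Heegner point non-torsion, `rank E(K) = 1`
  have hD0 : (NumberField.discr K : ℚ) ≠ 0 := by exact_mod_cast NumberField.discr_ne_zero K
  haveI hEt : (W.quadraticTwist (NumberField.discr K : ℚ)).IsElliptic := W.isElliptic_quadraticTwist hD0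
  have hL0W : W.entireLFunction 1 ≠ 0 := (W.analyticRank_eq_zero_iff_holds (hmod W)).mp hr0
  have hLt' : (W.quadraticTwist (NumberField.discr K : ℚ)).entireLFunction = Wd.entireLFunction := by
    rw [← hWd, entireLFunction_smul]
  have hrt : (W.quadraticTwist (NumberField.discr K : ℚ)).analyticRank = 1 := by
    rw [← hrd, ← hWd, analyticRank_smul]
  have hLt0 : (W.quadraticTwist (NumberField.discr K : ℚ)).entireLFunction 1 = 0 :=
    entireLFunction_one_eq_zero_of_analyticRank_eq_one hrt
  obtain ⟨-, hderivd⟩ := leadingLCoeff_eq_deriv_of_analyticRank_eq_one hrd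
  have hderivt : deriv (W.quadraticTwist (NumberField.discr K : ℚ)).entireLFunction 1 ≠ 0 := by
    rw [hLt']; exact hderivd
  have hLK : LDerivEK W K ≠ 0 := by
    rw [AdditivePotMult.lDerivEK_eq_mul_deriv W K hmod hLt0]
    exact mul_ne_zero hL0W hderivt
  have hPinf : ¬ IsOfFinAddOrder P :=
    (lDerivEK_ne_zero_iff_not_isOfFinAddOrder W N K (hGZ N W K) hK hHN hPH).mp hLK
  obtain ⟨hrk, -⟩ := hKo N W K hK hHN hPH hPinf
  -- the anticyclotomic datum and display (5.5) at the datum (Thm. 4.2.2 ∘ 5.1.3 + Thm. 5.1.1)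
  obtain ⟨κ, γ, 𝔭, hκ, hγ, h𝔭, he, hf⟩ := X11b.exists_anticyclotomic_generator_degreeOnePrime p K hK hHp
  haveI : Fact (κ.IsTopGenerator γ) := ⟨hγ⟩
  obtain ⟨vbar, hvbar, hne⟩ := X11b.exists_other_prime hHp
    (X11b.inducedPlace (X11b.embAt K p 𝔭 h𝔭 he hf)) (X11b.natCast_mem_inducedPlace _)
  have h55 := display55_at_of_display54_of_thm511 h54 h511 hp hgood hred hna hK hodd (by omega) hHN'
    hHp (X11b.embAt K p 𝔭 h𝔭 he hf) (X11b.inducedPlace (X11b.embAt K p 𝔭 h𝔭 he hf)) vbar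
    (X11b.mem_inducedPlace_iff _) hvbar hne κ hκ γ Dt H ι P hP hrk hfinK hPinf
  -- the Tamagawa relation over `K`, the Manin bit, the torsion bit
  have hpd : ¬ (p : ℤ) ∣ NumberField.discr K := not_dvd_discr_of_split hK hpP hp2 hHp
  have htam : padicValNat p (W.baseChange K).tamagawaProduct =
      padicValNat p W.tamagawaProduct + padicValNat p Wd.tamagawaProduct :=
    X11b.padicValNat_tamagawaProduct_baseChange_quadratic_of_heegner_of_odd W p K Wd hp2 hK hodd hpd
      hHN' hWd
  have hcv : padicValInt p Dt.c = 0 := padicValInt.eq_zero_of_not_dvd hc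
  have ht : padicValNat p W.torsionOrder = 0 :=
    padicValNat.eq_zero_of_not_dvd (not_dvd_torsionOrder_of_not_anom W p hp hgood hna)
  -- `BSD(E^K,p)`: `ord_p #Ш_an(Wd) = ord_p #Ш(Wd)`
  obtain ⟨-, hfinD⟩ := hGZK Wd (by omega)
  haveI : Finite Wd.sha := hfinD
  have hvq : padicValRat p q = padicValNat p Wd.shaOrder := by
    obtain ⟨-, -, q', hq', hv'⟩ := hBd
    have hqq : q = q' := by exact_mod_cast hq.symm.trans hq'
    subst hqq
    rw [hv', WeierstrassCurve.shaOrder, padicValNat_card_addPrimaryComponent]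
  -- assemble the rank-zero print shape of `W`
  have h1 : ((padicValNat p (W.baseChange K).shaOrder : ℕ) : ℤ) =
      (padicValNat p W.shaOrder : ℤ) + (padicValNat p Wd.shaOrder : ℤ) := by exact_mod_cast hshaK
  have h2 : ((padicValNat p (W.baseChange K).tamagawaProduct : ℕ) : ℤ) =
      (padicValNat p W.tamagawaProduct : ℤ) + (padicValNat p Wd.tamagawaProduct : ℤ) := by
    exact_mod_cast htam
  rw [hcv] at h55
  simp only [Nat.cast_zero, sub_zero] at h55
  rw [ht] at hval
  simp only [Nat.cast_zero, mul_zero, add_zero] at hval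
  have key : padicValRat p q0 =
      (padicValNat p W.shaOrder : ℤ) + (padicValNat p W.tamagawaProduct : ℤ) := by
    linarith [h1, h2, h55, hval, hvq]
  refine bsdp_of_pPartRankZero W p hmod hGZK hr0 ⟨q0, hq0, ?_⟩
  rw [ht, key]
  simp only [Nat.cast_zero, mul_zero, sub_zero]

/-- **Row D4 ∩ {r = 0}, PER CLASS, TWO-STEP TWIST CERTIFICATE — refereed Beilinson–Flach-free print
only.** Data: `W`, `p`, `Dt` (`p ∤ c(Dt)`), `K`, `Wd = Cd • E^{(d_K)}` of analytic rank `1` as in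
`RowC6.bsdp_rankZero_of_mainConjectures_of_bsdp_twist`; a SECOND imaginary quadratic field `K'`
(`d_{K'}` odd `< −4`, Heegner for the conductor of `Wd`, `p` split) with `L(Wd^{(d_{K'})},1) ≠ 0`, and a
globally minimal model `Wdd` of `Wd^{(d_{K'})}` (a quadratic twist of `E` by the REAL field
`ℚ(√(d_K d_{K'}))`) whose `#Ш_an` is a rational `p`-adic unit. Then `BSDp W p`: the twist `Wd` is a
rank-one good Eisenstein non-anomalous curve at `p` (`partner_good_red_not_anom`), so the rank-ONE
twist road `RowC6.bsdp_rankOne_of_display55_of_twistShaAnUnit` (display (5.5) itself DERIVED from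
A173 + A170, `display55_of_display54_of_thm511`; Wuthrich 2014 Prop. 21 `hW` on `Wdd`) gives
`BSDp Wd p`, and the mirror step transfers it to `W`. Named facts: A173, A170, C14, modularity,
Gross–Zagier (both currencies), Kolyvagin, GZK — no CGS25 / BSTW / `_OPEN` / flag binder.
[cite: CastellaGrossiLeeSkinner2022, Thm. 4.2.2, Thm. 5.1.1, Thm. 5.1.3, proof of Thm. 5.3.1 (5.4)–(5.7)]
[cite: Wuthrich2014, Prop. 21 (p. 400)] [cite: GrossZagier1986, I.(6.5), V.§2, Thm. I.7.3]
[cite: Miller2011LMS, Def. 1.1] -/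
theorem RowC6.bsdp_rankZero_of_mainConjectures_of_twoStepTwist
    (h54 : display54_thm513_generator_constantCoeff) (h511 : thm511_anticyclotomicControl)
    (hW : Wuthrich2014.sha_dvd_analyticSha)
    (hmodP : nonempty_modularParametrizationData) (hnf : exists_isNewformOf)
    (hGZQ : GrossZagier1986_thm_I_7_3)
    (hGZ : ∀ (N : ℕ) [NeZero N] (W : WeierstrassCurve ℚ) (K : Type) [Field K] [NumberField K],
      gross_zagier N W K)
    (hKo : ∀ (N : ℕ) [NeZero N] (W : WeierstrassCurve ℚ) (K : Type) [Field K] [NumberField K],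
      kolyvagin N W K)
    (hGZK : rank_eq_analyticRank_of_analyticRank_le_one)
    (W : WeierstrassCurve ℚ) [W.IsElliptic] [W.IsGloballyMinimal] (p : ℕ) [Fact p.Prime]
    (hp : 2 < p) (hgood : Good W p) (hred : Red W p) (hna : ¬ Anom W p) (hr0 : W.analyticRank = 0)
    (N : ℕ) [NeZero N] (Dt : ModularParametrizationData W N) (hc : ¬ (p : ℤ) ∣ Dt.c)
    (K : Type) [Field K] [NumberField K] (hK : IsImaginaryQuadratic K)
    (hodd : Odd (NumberField.discr K)) (hlt : NumberField.discr K < -4)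
    (hHN : SatisfiesHeegnerHypothesis N K) (hHp : SatisfiesHeegnerHypothesis p K)
    (Wd : WeierstrassCurve ℚ) [Wd.IsElliptic] [Wd.IsGloballyMinimal] (Cd : VariableChange ℚ)
    (hWd : Cd • W.quadraticTwist (NumberField.discr K : ℚ) = Wd) (hrd : Wd.analyticRank = 1)
    (K' : Type) [Field K'] [NumberField K'] (hK' : IsImaginaryQuadratic K')
    (hodd' : Odd (NumberField.discr K')) (hlt' : NumberField.discr K' < -4)
    (hHN' : SatisfiesHeegnerHypothesis (Wd.conductorNorm ℤ) K') (hHp' : SatisfiesHeegnerHypothesis p K')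
    (hLt' : (Wd.quadraticTwist (NumberField.discr K' : ℚ)).entireLFunction 1 ≠ 0)
    (Wdd : WeierstrassCurve ℚ) [Wdd.IsElliptic] [Wdd.IsGloballyMinimal]
    (hWdd : ∃ C : VariableChange ℚ, C • Wdd = Wd.quadraticTwist (NumberField.discr K' : ℚ))
    (hunit : ∃ q : ℚ, shaAn Wdd = (q : ℂ) ∧ padicValRat p q = 0) : BSDp W p := by
  -- the twist is a rank-one row-C6 curve at `p`
  have hWd' : ∃ C : VariableChange ℚ, C • Wd = W.quadraticTwist (NumberField.discr K : ℚ) :=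
    ⟨Cd⁻¹, by rw [← hWd, inv_smul_smul]⟩
  obtain ⟨hgood_d, hred_d, hna_d⟩ := partner_good_red_not_anom hp hgood hred hna K hK hodd hHp Wd hWd'
  -- step 1: the rank-ONE twist road on `Wd` with the field `K'` ((5.5) from A173 + A170)
  have hBd : BSDp Wd p :=
    RowC6.bsdp_rankOne_of_display55_of_twistShaAnUnit (display55_of_display54_of_thm511 h54 h511 hnf hGZ hGZK)
      hW hmodP hnf hGZQ hGZ hKo hGZK Wd p hp hgood_d hred_d hna_d hrd K' hK' hodd' hlt' hHN' hHp' hLt' Wdd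
      hWdd hunit
  -- step 2: the mirror transfer to `W`
  exact RowC6.bsdp_rankZero_of_mainConjectures_of_bsdp_twist h54 h511 hmodP hnf hGZ hKo hGZK W p hp
    hgood hred hna hr0 N Dt hc K hK hodd hlt hHN hHp Wd Cd hWd hrd hBd

end Summit.BirchSwinnertonDyer.Rank1Residual

end
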